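import Summits.CriticalPhenomena.PercolationContinuityZ3.Theorems.Transplant.SkelFrmFromBParamsFaceFloorsClrXA
import Summits.CriticalPhenomena.PercolationContinuityZ3.Theorems.Transplant.SkelFrmBParamsFaceFloorsClrXA
import Summits.CriticalPhenomena.PercolationContinuityZ3.Theorems.Transplant.SkelFrmFromBParamsFaceFloorsPiXA
import Summits.CriticalPhenomena.PercolationContinuityZ3.Theorems.Transplant.SkelFrmBParamsFaceFloorsPiXA
import Summits.CriticalPhenomena.PercolationContinuityZ3.Theorems.Transplant.SkelFrmFromBParamsFaceFloorsFitXA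
import Summits.CriticalPhenomena.PercolationContinuityZ3.Theorems.Transplant.SkelFrmBParamsFaceFloorsFitXA
import Summits.CriticalPhenomena.PercolationContinuityZ3.Theorems.Transplant.PlanarSkeletonFrmFromDefs
import Summits.CriticalPhenomena.PercolationContinuityZ3.Theorems.Transplant.PlanarSkeletonFrmDefs
import Summits.CriticalPhenomena.PercolationContinuityZ3.Theorems.Transplant.SkelPhiStepIDataNS
import HarnessLib
import Summits.CriticalPhenomena.PercolationContinuityZ3.Theorems.Transplant.SkelFrmBParamsFaceFloorsXGenA
/-!
# U-WAVE PORT (RULING D-U, lead g21 2026-08-26; WAVE-U-MANIFEST v3.1 row «SkelFrmBParamsFaceFloorsXGenA» ↦ «SkelFrmFromBParamsFaceFloorsXGenA») of the tree module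
# `Transplant/SkelFrmBParamsFaceFloorsXGenA` onto the carrier `PlanarSkeletonFrmFrom` (frames only, cylinders connected from width `ℓ₀` on)

ORIGINAL TITLE: N2 (frames-only node, OPEN) — (F) value layer under (R-44)(c): **THE σT- and N₃-GENERIC TWINS OF THE PINNED x-FACE FIELDS** (hp-8 g43)

builds on p205010 (kernel theorem, internal audit signed; external expert review pending) — nothing in this file uses p205010; NOTHING is claimed about the
OPEN node U `SamePDropOfSkeletonFrmFrom₁` (nor U_s / the end state).  Lane `prim-bschramm`, seat `prim-bschramm-stmt` gen 26 (port pen, RULING M-11 family P-stmt; tool = p3-g26's port_u.py of record, registry-driven inputs); helper file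
(`--supports stmt-CriticalPhenomena-4575 --as helper`).  PORT RULES r1–r4 of RULING D-U: declaration order and proof texts are those of the original,
byte-identical except (i) the carrier token `PlanarSkeletonFrm ↦ PlanarSkeletonFrmFrom` (binders, `namespace`/`end` lines, qualified names of twinned
declarations), (ii) carrier-FREE declarations of the original (φ-level `Skelφ…` blocks and namespace-only arithmetic residents) are NOT re-declared —
this file imports the original and `export`s the twin-free residents (POLICY T / treatment (m1)); residents whose statement mentions a twinned
constant are copied, (iii) every carrier-binding declaration keeps its explicit binder `(Φ : PlanarSkeletonFrmFrom G)` in its own signature (r2).  Docstrings and citations are the original's.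
-/

noncomputable section

open scoped Classical

namespace Summit.CriticalPhenomena.PercolationContinuityZ3.Theorems.Transplant

namespace PlanarSkeletonFrmFrom

namespace NegB

open Literature.Probability.Percolation Literature.Probability.LatticeModels SimpleGraph
open Literature.Probability.Percolation.KozmaNitzan.Cells (oth sgOf sgOf_sign)
open SkelConc (Consts)
open Skelφ (shearUnit shearUnit_pos xBoxLoA yBoxLoT yBoxHiT yBoxLoS crossOffX yPrmW)
open Skelφ.StepI (DataN)
open TwoAxis.Para (modulus)
open Neg

namespace KS

export PlanarSkeletonNeg.NegB.KS (clr_kterm_le)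

/-- (R-44)(c) GENERIC TWIN (any tangential sign `σT = ±1`, any count `N₃` in range; hp-8 g43) of **M3 x-face field `hclr₃`** at the (ζ′) tuple (pinned conclusion; premise block trimmed; NO added hypothesis): every region of the tangential
y′-run is clear of the seed box — by abscissa for `k ≤ 30`, by level for `k ≥ 31`. [cite: KozmaNitzan2024, §4 Lemma 12 (pp. 23–25)]
[cite: MartineauTassion2017, §4.3 Lemma 4.2] -/
theorem hclr₃_XA_gen (κ : Consts) {V : Type} [DecidableEq V] [Countable V] {G : SimpleGraph V} [G.LocallyFinite] (Φ : PlanarSkeletonFrmFrom G) (t : V) (p : unitInterval) (D : Skelφ.StepI.DataNS V) (mk : ℕ) (g : ℕ) (f : ℕ) (P : PCells2T) (hP : P.toPCells2 = fcellsA κ Φ t p D g f) (hN : EqNumL κ Φ t p D g f) (hκ : (hL κ Φ t p D g f).natAbs ≤ 10 * nL κ Φ t p D g f)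
    (hnA : 2000 * Neg.Kq κ * (KS0.R'0 κ Φ t p D mk + 2) ≤ nL κ Φ t p D g f) (hℓA : 22000 * Neg.Kq κ * (KS0.R'0 κ Φ t p D mk + 2) ≤ ℓL κ Φ t p D g f)
    (x : Site 2) (du : MDir) (hd : du.1 = 0) (j : ℕ) (hj : j < P.K) (z : Site 2) {E : ℕ}
    (hlev1 : P.faceL 0 j - E ≤ P.lev du x z) (hlev2 : P.lev du x z ≤ P.faceL 0 j + E)
    (hEu : (E : ℤ) ≤ u₀A κ Φ t p D g f)
    (yL : Site 2) {σT : ℤ} (hσT : σT = 1 ∨ σT = -1) (N₃ : ℕ) (he0 : |FcA κ Φ t p D g f (yTX0 κ Φ t p D g f yL σT)| ≤ 6 * u₀A κ Φ t p D g f)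
    (he1 : |F1cA κ Φ t p D g f yL| ≤ 6 * u₁A κ Φ t p D g f) :
    ∀ k ≤ N₃, (∀ b : ℤ, min (σT * yBoxLoT (nL κ Φ t p D g f) (prFA κ Φ t p D g f).vα (KS0.R'0 κ Φ t p D mk) k) (σT * yBoxHiT (nL κ Φ t p D g f) (prFA κ Φ t p D g f).vα (KS0.R'0 κ Φ t p D mk) k) ≤ b → b ≤ max (σT * yBoxLoT (nL κ Φ t p D g f) (prFA κ Φ t p D g f).vα (KS0.R'0 κ Φ t p D mk) k) (σT * yBoxHiT (nL κ Φ t p D g f) (prFA κ Φ t p D g f).vα (KS0.R'0 κ Φ t p D mk) k) → ((Mu D : ℕ) : ℤ) < sgOf du * (b + (yL + crossOffX (nL κ Φ t p D g f) (prFA κ Φ t p D g f).h (prFA κ Φ t p D g f).vα (sgOf du) σT (NrX κ Φ t p D g f P yL σT x du z)) 0)) ∨ ((shearUnit (nL κ Φ t p D g f) (prFA κ Φ t p D g f).h : ℤ) * (Mu D) + |(((nL κ Φ t p D g f) : ℕ) : ℤ) * (yL + crossOffX (nL κ Φ t p D g f) (prFA κ Φ t p D g f).h (prFA κ Φ t p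 D g f).vα (sgOf du) σT (NrX κ Φ t p D g f P yL σT x du z)) 1 - (prFA κ Φ t p D g f).h * (yL + crossOffX (nL κ Φ t p D g f) (prFA κ Φ t p D g f).h (prFA κ Φ t p D g f).vα (sgOf du) σT (NrX κ Φ t p D g f P yL σT x du z)) 0| < (shearUnit (nL κ Φ t p D g f) (prFA κ Φ t p D g f).h : ℤ) * yBoxLoS (nL κ Φ t p D g f) (ℓL κ Φ t p D g f) (prFA κ Φ t p D g f).h (qB3XA κ Φ t p D g f (KS0.R'0 κ Φ t p D mk)) (KS0.R'0 κ Φ t p D mk) k) := by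
  have eh : (prFA κ Φ t p D g f).h = hL κ Φ t p D g f := rfl
  have ev : (prFA κ Φ t p D g f).vα = vL κ Φ t p D g f := rfl
  simp only [eh, ev]
  intro k hk
  obtain ⟨hn1, hℓ1⟩ := one_le_of_eqNumL κ Φ t p D g f hN
  have hn0 : (1 : ℤ) ≤ (nL κ Φ t p D g f : ℤ) := by exact_mod_cast hn1
  have hv := hN.v_le
  have hσ : sgOf du = 1 ∨ sgOf du = -1 := sgOf_sign du
  have hq1 : (1 : ℤ) ≤ (Neg.Kq κ : ℤ) := by exact_mod_cast Neg.one_le_Kq κ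
  have hR0 : (0 : ℤ) ≤ (KS0.R'0 κ Φ t p D mk : ℤ) := Nat.cast_nonneg _
  have hnA' : 2000 * (Neg.Kq κ : ℤ) * ((KS0.R'0 κ Φ t p D mk : ℤ) + 2) ≤ (nL κ Φ t p D g f : ℤ) := by exact_mod_cast hnA
  have hℓA' : 22000 * (Neg.Kq κ : ℤ) * ((KS0.R'0 κ Φ t p D mk : ℤ) + 2) ≤ (ℓL κ Φ t p D g f : ℤ) := by exact_mod_cast hℓA
  have hMz : ((Mu D : ℕ) : ℤ) + 2 ≤ (KS0.R'0 κ Φ t p D mk : ℤ) := by exact_mod_cast Mu_add_two_le_R'0 κ Φ t p D mk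
  have hℓ2 : 2 ≤ ℓL κ Φ t p D g f := by
    have : (2 : ℤ) ≤ (ℓL κ Φ t p D g f : ℤ) := by nlinarith
    exact_mod_cast this
  by_cases hk30 : k ≤ 30
  · -- the α-branch: the region's transverse range is far on the `σ` side
    left
    have hNr := clr_NrX_lb κ Φ t p D g f P hP hN x du hd z hj hlev1 hlev2 hEu yL σT he0
    have hy0 := abs_le.1 (clr_abs_yTX0_zero_le κ Φ t p D g f hN hℓ2 yL σT he0 he1)
    refine clr_tan_alpha_of_room hv (KS0.R'0 κ Φ t p D mk) k hσ hσT ?_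
    -- `σ·yT 0 = σ·(yTX0 yL σT) 0 + (Nr+1)·n ≥ −15n + (200Q − 7)·n`
    rw [crossOffX_eq, Pi.add_apply, Skelφ.pt_zero]
    set σ := sgOf du
    set N : ℤ := (NrX κ Φ t p D g f P yL σT x du z : ℤ)
    set n : ℤ := (nL κ Φ t p D g f : ℤ)
    set Y := yTX0 κ Φ t p D g f yL σT 0
    have hk' : (k : ℤ) ≤ 30 := by exact_mod_cast hk30
    have hσsq : σ * σ = 1 := by rcases hσ with h | h <;> rw [h] <;> norm_num
    have e2 : σ * (Y + σ * (N + 1) * n) = σ * Y + (N + 1) * n := by linear_combination ((N + 1) * n) * hσsq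
    rw [e2]
    have hσy : -(15 * n) ≤ σ * Y := by
      rcases hσ with h | h <;> rw [h] <;> linarith [hy0.1, hy0.2]
    have hNn : (200 * (Neg.Kq κ : ℤ) - 7) * n ≤ (N + 1) * n := mul_le_mul_of_nonneg_right (by linarith) (by linarith)
    have hkn : ((k : ℤ) + 3) * n ≤ 33 * n := mul_le_mul_of_nonneg_right (by linarith) (by linarith)
    have hkR : ((k : ℤ) + 1) * (KS0.R'0 κ Φ t p D mk : ℤ) ≤ 31 * (KS0.R'0 κ Φ t p D mk : ℤ) := mul_le_mul_of_nonneg_right (by linarith) hR0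
    nlinarith
  · -- the level branch: the region sits `≥ 31` level strides above the origin
    right
    push Not at hk30
    have hk31 : (31 : ℤ) ≤ (k : ℤ) := by exact_mod_cast hk30
    obtain ⟨hU1, hU2⟩ := clr_shearUnit_bounds κ Φ t p D g f hκ
    obtain ⟨-, hm2⟩ := Skelφ.NegPrm.modulus_vβOf hn1 (hL κ Φ t p D g f) (ℓL κ Φ t p D g f) (vL κ Φ t p D g f)
    have e : Skelφ.NegPrm.vβOf (nL κ Φ t p D g f) (hL κ Φ t p D g f) (ℓL κ Φ t p D g f) (vL κ Φ t p D g f) = vβL κ Φ t p D g f := rfl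
    rw [e] at hm2
    have hlv := clr_abs_lvl_yT_le κ Φ t p D g f hN yL he1 (sgOf du) σT (NrX κ Φ t p D g f P yL σT x du z)
    have hs := clr_mul_sLo_ge hn1 (hL κ Φ t p D g f) (ℓL κ Φ t p D g f)
    obtain ⟨hW, hLb⟩ := Wrun_spec κ Φ t p D g f hn1
    unfold Lbrun at hLb
    unfold Wrun at hW
    have hq : (shearUnit (nL κ Φ t p D g f) (hL κ Φ t p D g f) : ℤ) * (qB3XA κ Φ t p D g f (KS0.R'0 κ Φ t p D mk) : ℤ) ≤
        (nL κ Φ t p D g f : ℤ) * (ℓL κ Φ t p D g f : ℤ) + 3 * (shearUnit (nL κ Φ t p D g f) (hL κ Φ t p D g f) : ℤ) +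
          1000 * (Neg.Kq κ : ℤ) * (KS0.R'0 κ Φ t p D mk : ℤ) * (shearUnit (nL κ Φ t p D g f) (hL κ Φ t p D g f) : ℤ) := by
      have eq : (qB3XA κ Φ t p D g f (KS0.R'0 κ Φ t p D mk) : ℤ) =
          ((nL κ Φ t p D g f * ℓL κ Φ t p D g f / shearUnit (nL κ Φ t p D g f) (hL κ Φ t p D g f) + 1 : ℕ) : ℤ) +
            1000 * (Neg.Kq κ : ℤ) * (KS0.R'0 κ Φ t p D mk : ℤ) + 2 := by
        unfold qB3XA Wrun; push_cast; ring
      rw [eq]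
      set U : ℤ := (shearUnit (nL κ Φ t p D g f) (hL κ Φ t p D g f) : ℤ)
      set W : ℤ := ((nL κ Φ t p D g f * ℓL κ Φ t p D g f / shearUnit (nL κ Φ t p D g f) (hL κ Φ t p D g f) + 1 : ℕ) : ℤ)
      have hU0 : 0 ≤ U := by linarith
      have : U * (W + 1000 * (Neg.Kq κ : ℤ) * (KS0.R'0 κ Φ t p D mk : ℤ) + 2) = U * W + 2 * U + 1000 * (Neg.Kq κ : ℤ) * (KS0.R'0 κ Φ t p D mk : ℤ) * U := by ring
      rw [this]
      linarith
    unfold Skelφ.yBoxLoS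
    exact clr_tan_level_arith hn0 hU1 hU2 hR0 hq1 hℓA' hm2 hMz hlv hk31 hs hq hLb

/-- (R-44)(c) GENERIC TWIN (any tangential sign `σT = ±1`, any count `N₃` in range; hp-8 g43) of **M3 x-face field `hπ2X`** at the (ζ′) tuple (pinned conclusion; premise block trimmed; added served hyps `hSF`, `hyl`, `hr`): the along run's
sheared prism lies within the window radius. [cite: KozmaNitzan2024, §4 Lemma 12 (pp. 23–25)] -/
theorem hπ2X_XA_gen (κ : Consts) {V : Type} [DecidableEq V] [Countable V] {G : SimpleGraph V} [G.LocallyFinite] (Φ : PlanarSkeletonFrmFrom G) (t : V) (p : unitInterval) (D : Skelφ.StepI.DataNS V) (c : ℕ) (mk : ℕ) (g : ℕ) (f : ℕ) (P : PCells2T) (hP : P.toPCells2 = fcellsA κ Φ t p D g f) (hN : EqNumL κ Φ t p D g f)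
    (x : Site 2) (du : MDir) (hd : du.1 = 0) (j : ℕ) (hj : j < P.K) (z : Site 2) {E : ℕ}
    (hlev1 : (P.faceL 0 j : ℤ) - E ≤ P.lev du x z) (hlev2 : P.lev du x z ≤ P.faceL 0 j + E)
    (hEu : (E : ℤ) ≤ u₀A κ Φ t p D g f)
    (yL : Site 2) (σT : ℤ) (he0 : |FcA κ Φ t p D g f (yTX0 κ Φ t p D g f yL σT)| ≤ 6 * u₀A κ Φ t p D g f)
    (hyl : (yL 0).natAbs + (yL 1).natAbs ≤ YbF κ Φ t p D c mk g f) (r : ℕ) (hr : πBudX κ Φ t p D c mk g f ≤ r) :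
    ((yL 0).natAbs + (yL 1).natAbs) + ((NrX κ Φ t p D g f P yL σT x du z) + 1) * shearUnit (nL κ Φ t p D g f) (prFA κ Φ t p D g f).h ≤ r := by
  have eh : (prFA κ Φ t p D g f).h = hL κ Φ t p D g f := rfl
  rw [eh]
  have hu : 1 ≤ u₀A κ Φ t p D g f := (units_eqA κ Φ t p D g f).2.2.2.2.1
  obtain ⟨-, hNr⟩ := NrX_range κ Φ t p D g f P hP hN x du hd z hj hlev1 hlev2 yL σT he0 (by linarith)
  refine le_trans ?_ hr
  unfold πBudX
  have h1 : (NrX κ Φ t p D g f P yL σT x du z + 1) * shearUnit (nL κ Φ t p D g f) (hL κ Φ t p D g f) ≤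
      600 * Neg.Kq κ * shearUnit (nL κ Φ t p D g f) (hL κ Φ t p D g f) := Nat.mul_le_mul_right _ hNr
  omega

/-- (R-44)(c) GENERIC TWIN (any tangential sign `σT = ±1`, any count `N₃` in range; hp-8 g43) of **M3 x-face field `hπ3X`** at the (ζ′) tuple (pinned conclusion; premise block trimmed; added served hyps `hSF`, `hyl`, `hr`): the tangential
y′-run's origin plus every region's drift lies within the window radius. [cite: KozmaNitzan2024, §4 Lemma 12 (pp. 23–25)] -/
theorem hπ3X_XA_gen (κ : Consts) {V : Type} [DecidableEq V] [Countable V] {G : SimpleGraph V} [G.LocallyFinite] (Φ : PlanarSkeletonFrmFrom G) (t : V) (p : unitInterval) (D : Skelφ.StepI.DataNS V) (c : ℕ) (mk : ℕ) (g : ℕ) (f : ℕ) (P : PCells2T) (hP : P.toPCells2 = fcellsA κ Φ t p D g f) (hN : EqNumL κ Φ t p D g f) (hκ : (hL κ Φ t p D g f).natAbs ≤ 10 * nL κ Φ t p D g f)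
    (hℓA : 22000 * Neg.Kq κ * (KS0.R'0 κ Φ t p D mk + 2) ≤ ℓL κ Φ t p D g f)
    (x : Site 2) (du : MDir) (hd : du.1 = 0) (j : ℕ) (hj : j < P.K) (z : Site 2) {E : ℕ}
    (hlev1 : (P.faceL 0 j : ℤ) - E ≤ P.lev du x z) (hlev2 : P.lev du x z ≤ P.faceL 0 j + E)
    (hEu : (E : ℤ) ≤ u₀A κ Φ t p D g f)
    (yL : Site 2) {σT : ℤ} (hσT : σT = 1 ∨ σT = -1) {N₃ : ℕ} (hN₃ : N₃ + 1 ≤ 240 * Neg.Kq κ + 10) (he0 : |FcA κ Φ t p D g f (yTX0 κ Φ t p D g f yL σT)| ≤ 6 * u₀A κ Φ t p D g f)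
    (hyl : (yL 0).natAbs + (yL 1).natAbs ≤ YbF κ Φ t p D c mk g f) (r : ℕ) (hr : πBudX κ Φ t p D c mk g f ≤ r) :
    ∀ k ≤ N₃, (((yL + crossOffX (nL κ Φ t p D g f) (prFA κ Φ t p D g f).h (prFA κ Φ t p D g f).vα (sgOf du) σT (NrX κ Φ t p D g f P yL σT x du z)) 0).natAbs + ((yL + crossOffX (nL κ Φ t p D g f) (prFA κ Φ t p D g f).h (prFA κ Φ t p D g f).vα (sgOf du) σT (NrX κ Φ t p D g f P yL σT x du z)) 1).natAbs) + (((((k + 1 : ℕ) : ℤ) * (prFA κ Φ t p D g f).vα).natAbs + (((shearUnit (nL κ Φ t p D g f) (prFA κ Φ t p D g f).h : ℤ) * |((k + 1 : ℕ) : ℤ) * (yPrmW (nL κ Φ t p D g f) (ℓL κ Φ t p D g f) (prFA κ Φ t p D g f).h (prFA κ Φ t p D g f).vα (KS0.R'0 κ Φ t p D mk) (qB3XA κ Φ t p D g f (KS0.R'0 κ Φ t p D mk)) N₃).sLo| + |(prFA κ Φ t p D g f).h| * |((k + 1 : ℕ) : ℤ) * (prFA κ Φ t p D g f).vα| + shearUnit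 (nL κ Φ t p D g f) (prFA κ Φ t p D g f).h) / (nL κ Φ t p D g f)).natAbs + 1)) ≤ r := by
  have eh : (prFA κ Φ t p D g f).h = hL κ Φ t p D g f := rfl
  have ev : (prFA κ Φ t p D g f).vα = vL κ Φ t p D g f := rfl
  simp only [eh, ev]
  intro k hk
  obtain ⟨hn1, -⟩ := one_le_of_eqNumL κ Φ t p D g f hN
  have hn0 : (0 : ℤ) < (nL κ Φ t p D g f : ℤ) := by exact_mod_cast hn1
  have hu0 : 1 ≤ u₀A κ Φ t p D g f := (units_eqA κ Φ t p D g f).2.2.2.2.1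
  have hu1 : 1 ≤ u₁A κ Φ t p D g f := (units_eqA κ Φ t p D g f).2.2.2.2.2
  have hσ : sgOf du = 1 ∨ sgOf du = -1 := sgOf_sign du
  have hU := shearUnit_pos hn1 (hL κ Φ t p D g f)
  obtain ⟨-, hU2⟩ := clr_shearUnit_bounds κ Φ t p D g f hκ
  have hκ' : |hL κ Φ t p D g f| ≤ 10 * (nL κ Φ t p D g f : ℤ) := by rw [← Int.natCast_natAbs]; exact_mod_cast hκ
  have hq1 : 1 ≤ Neg.Kq κ := Neg.one_le_Kq κ
  have hℓ11 : (11 : ℤ) ≤ (ℓL κ Φ t p D g f : ℤ) := by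
    have h2 : 1 * (0 + 2) ≤ Neg.Kq κ * (KS0.R'0 κ Φ t p D mk + 2) := Nat.mul_le_mul hq1 (by omega)
    have : 11 ≤ ℓL κ Φ t p D g f := by nlinarith only [hℓA, h2]
    exact_mod_cast this
  have hnℓ : (nL κ Φ t p D g f : ℤ) * 11 ≤ (nL κ Φ t p D g f : ℤ) * ℓL κ Φ t p D g f := mul_le_mul_of_nonneg_left hℓ11 hn0.le
  have sL' : (shearUnit (nL κ Φ t p D g f) (hL κ Φ t p D g f) : ℤ) * sLoY κ Φ t p D g f ≤
      (nL κ Φ t p D g f : ℤ) * ℓL κ Φ t p D g f - (shearUnit (nL κ Φ t p D g f) (hL κ Φ t p D g f) : ℤ) + 1 := by unfold sLoY; exact Int.mul_ediv_self_le hU.ne'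
  have hs0 : 0 ≤ sLoY κ Φ t p D g f := by unfold sLoY; exact Int.ediv_nonneg (by linarith only [hU2, hnℓ]) hU.le
  obtain ⟨-, hNr⟩ := NrX_range κ Φ t p D g f P hP hN x du hd z hj hlev1 hlev2 yL σT he0 (by linarith only [hEu, hu0])
  have hk1 : ((k + 1 : ℕ) : ℤ) ≤ 1000 * (Neg.Kq κ : ℤ) := by
    have h3 : k + 1 ≤ 1000 * Neg.Kq κ := by have := Neg.one_le_Kq κ; omega
    exact_mod_cast h3
  have hterm := clr_kterm_le hn1 hN.v_le hκ' hU2 hs0 (by linarith only [sL', hU]) (by positivity : (0 : ℤ) ≤ (ℓL κ Φ t p D g f : ℤ))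
    (Nat.cast_nonneg _ : (0 : ℤ) ≤ ((k + 1 : ℕ) : ℤ)) hk1
  have hNn0 : 0 ≤ (shearUnit (nL κ Φ t p D g f) (hL κ Φ t p D g f) : ℤ) * |((k + 1 : ℕ) : ℤ) * sLoY κ Φ t p D g f| +
      |hL κ Φ t p D g f| * |((k + 1 : ℕ) : ℤ) * vL κ Φ t p D g f| + (shearUnit (nL κ Φ t p D g f) (hL κ Φ t p D g f) : ℤ) := by
    have a1 := mul_nonneg hU.le (abs_nonneg (((k + 1 : ℕ) : ℤ) * sLoY κ Φ t p D g f))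
    have a2 := mul_nonneg (abs_nonneg (hL κ Φ t p D g f)) (abs_nonneg (((k + 1 : ℕ) : ℤ) * vL κ Φ t p D g f))
    linarith only [a1, a2, hU]
  have hdiv0 := Int.ediv_nonneg hNn0 hn0.le
  have hNr' : (((NrX κ Φ t p D g f P yL σT x du z) : ℤ) + 1) * (shearUnit (nL κ Φ t p D g f) (hL κ Φ t p D g f) : ℤ) ≤
      600 * (Neg.Kq κ : ℤ) * (shearUnit (nL κ Φ t p D g f) (hL κ Φ t p D g f) : ℤ) := by
    have : (((NrX κ Φ t p D g f P yL σT x du z) : ℤ) + 1) ≤ 600 * (Neg.Kq κ : ℤ) := by exact_mod_cast hNr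
    exact mul_le_mul_of_nonneg_right this hU.le
  -- the large fact last
  have hT := clr_crossOffX_l1 κ Φ t p D g f hN hκ yL hσ hσT (NrX κ Φ t p D g f P yL σT x du z)
  refine le_trans ?_ hr
  unfold πBudX
  have hsLo : (yPrmW (nL κ Φ t p D g f) (ℓL κ Φ t p D g f) (hL κ Φ t p D g f) (vL κ Φ t p D g f) (KS0.R'0 κ Φ t p D mk)
      (qB3XA κ Φ t p D g f (KS0.R'0 κ Φ t p D mk)) N₃).sLo = sLoY κ Φ t p D g f := rfl
  rw [hsLo]
  rw [← Nat.cast_le (α := ℤ)] at hT hyl ⊢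
  push_cast at hdiv0 hterm
  push_cast [Int.natCast_natAbs] at hT hyl ⊢
  rw [abs_of_nonneg hdiv0]
  linarith only [hT, hyl, hNr', hterm]

/-- (R-44)(c) GENERIC TWIN (any tangential sign `σT = ±1`, any count `N₃` in range; hp-8 g43) of **`hfit` pinned** at the M3 skeleton's choice functions (added served hypothesis `hq4 : 4·qB ≤ n_L`). [folklore] -/
theorem hfit_XA_gen (κ : Consts) {V : Type} [DecidableEq V] [Countable V] {G : SimpleGraph V} [G.LocallyFinite] (Φ : PlanarSkeletonFrmFrom G) (t : V) (p : unitInterval) (D : Skelφ.StepI.DataNS V) (mk : ℕ) (g : ℕ) (f : ℕ) (P : PCells2T) (hP : P.toPCells2 = fcellsA κ Φ t p D g f) (hN : EqNumL κ Φ t p D g f)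
    (hnA : 2000 * Neg.Kq κ * (KS0.R'0 κ Φ t p D mk + 2) ≤ nL κ Φ t p D g f)
    (x : Site 2) (du : MDir) (hd : du.1 = 0) (j : ℕ) (hj : j < P.K) (z : Site 2) {E : ℕ}
    (hlev1 : P.faceL 0 j - E ≤ P.lev du x z) (hlev2 : P.lev du x z ≤ P.faceL 0 j + E)
    (hEu : (E : ℤ) ≤ u₀A κ Φ t p D g f)
    (yL : Site 2) (σT : ℤ) (he0 : |FcA κ Φ t p D g f (yTX0 κ Φ t p D g f yL σT)| ≤ 6 * u₀A κ Φ t p D g f) (qB : ℕ)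
    (hq4 : 4 * qB ≤ nL κ Φ t p D g f) :
    (qB : ℤ) + (((NrX κ Φ t p D g f P yL σT x du z) : ℤ) + 1) * (KS0.R'0 κ Φ t p D mk) ≤ (nL κ Φ t p D g f)  := by
  obtain ⟨-, hNr⟩ := NrX_range κ Φ t p D g f P hP hN x du hd z hj hlev1 hlev2 yL σT he0
    (by linarith [(units_eqA κ Φ t p D g f).2.2.2.2.1])
  obtain ⟨hNr', -, -⟩ := PlanarSkeletonNeg.NegB.KS.counts_budget κ (N₃ := 0) hNr (by have := Neg.one_le_Kq κ; omega)
  exact hfitX_RA κ Φ t p D g f mk hq4 le_rfl hNr' hnA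

/-- (R-44)(c) GENERIC TWIN (any tangential sign `σT = ±1`, any count `N₃` in range; hp-8 g43) of **`hq₃` pinned** at the M3 skeleton's choice functions. [folklore] -/
theorem hq₃_XA_gen (κ : Consts) {V : Type} [DecidableEq V] [Countable V] {G : SimpleGraph V} [G.LocallyFinite] (Φ : PlanarSkeletonFrmFrom G) (t : V) (p : unitInterval) (D : Skelφ.StepI.DataNS V) (mk : ℕ) (g : ℕ) (f : ℕ) (P : PCells2T) (hP : P.toPCells2 = fcellsA κ Φ t p D g f) (hN : EqNumL κ Φ t p D g f)
    (x : Site 2) (du : MDir) (hd : du.1 = 0) (j : ℕ) (hj : j < P.K) (z : Site 2) {E : ℕ}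
    (hlev1 : P.faceL 0 j - E ≤ P.lev du x z) (hlev2 : P.lev du x z ≤ P.faceL 0 j + E)
    (hEu : (E : ℤ) ≤ u₀A κ Φ t p D g f)
    (yL : Site 2) (σT : ℤ) (he0 : |FcA κ Φ t p D g f (yTX0 κ Φ t p D g f yL σT)| ≤ 6 * u₀A κ Φ t p D g f) :
    (((nL κ Φ t p D g f) * (ℓL κ Φ t p D g f) / shearUnit (nL κ Φ t p D g f) (prFA κ Φ t p D g f).h + 1 : ℕ) : ℤ) + (((NrX κ Φ t p D g f P yL σT x du z) : ℤ) + 1) * (KS0.R'0 κ Φ t p D mk) + 2 ≤ (qB3XA κ Φ t p D g f (KS0.R'0 κ Φ t p D mk))  := by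
  obtain ⟨-, hNr⟩ := NrX_range κ Φ t p D g f P hP hN x du hd z hj hlev1 hlev2 yL σT he0
    (by linarith [(units_eqA κ Φ t p D g f).2.2.2.2.1])
  obtain ⟨hNr', -, -⟩ := PlanarSkeletonNeg.NegB.KS.counts_budget κ (N₃ := 0) hNr (by have := Neg.one_le_Kq κ; omega)
  exact hq₃X_RA κ Φ t p D g f (KS0.R'0 κ Φ t p D mk) hNr'

end KS

end NegB

end PlanarSkeletonFrmFrom

end Summit.CriticalPhenomena.PercolationContinuityZ3.Theorems.Transplant

end
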